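import Summits.Ventures.PercRepro.SquarePos13Part4

/-!
# The square lemma, case analysis at position 13 (generated)

Dossier proofs/MINE1-theoremS.md, Addendum 82 (mine-1, gen 43). Generated by the lane's
`gen_square.py` from the P-uniform proof tree of `sqlazy2.c` for the position
`r ∈ b, r ∉ a, q ∈ b', q ∈ a'`: Boolean cores by `decide` (`sqb_*`), then the
rules of `ThetaOmegaCoreSquareRules.lean`; case analysis, level 4, module 5 of 5.
-/

namespace PercRepro.MSTight

open Finset

variable {α : Type*} [DecidableEq α] {U : Finset α} {F : Finset (Finset α)}
  {c0 c1 : Finset α → Bool} {q r : α} {b a b' a' : Finset α}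

/-- The square lemma at position 13 (generated case analysis). -/
theorem sq_core_pos13
    (H : SqCtx U F c0 c1 q r b a b' a') (hrb : r ∈ b) (hra : r ∉ a) (hqb' : q ∈ b')
    (hqa' : q ∈ a') (hδ : c1 b = false) (hε : c1 b' = false) :
    False := by
  rcases H.hKb with hKb | hb0
  · rcases H.hKa with hKa | ha0
    · rcases H.hKb' with hKb' | hb'0
      · rcases H.hKa' with hKa' | ha'0
        · exact sq_13_k0 H hrb hra hqb' hqa' hδ hε hKb hKa hKb' hKa'
        · exact absurd hqa' (by rw [ha'0]; exact notMem_empty q)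
      · rcases H.hKa' with hKa' | ha'0
        · exact absurd hqb' (by rw [hb'0]; exact notMem_empty q)
        · exact absurd hqb' (by rw [hb'0]; exact notMem_empty q)
    · rcases H.hKb' with hKb' | hb'0
      · rcases H.hKa' with hKa' | ha'0
        · exact sq_13_k2 H hrb hra hqb' hqa' hδ hε hKb ha0 hKb' hKa'
        · exact absurd hqa' (by rw [ha'0]; exact notMem_empty q)
      · rcases H.hKa' with hKa' | ha'0
        · exact absurd hqb' (by rw [hb'0]; exact notMem_empty q)
        · exact absurd hqb' (by rw [hb'0]; exact notMem_empty q)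
  · rcases H.hKa with hKa | ha0
    · rcases H.hKb' with hKb' | hb'0
      · rcases H.hKa' with hKa' | ha'0
        · exact absurd hrb (by rw [hb0]; exact notMem_empty r)
        · exact absurd hrb (by rw [hb0]; exact notMem_empty r)
      · rcases H.hKa' with hKa' | ha'0
        · exact absurd hrb (by rw [hb0]; exact notMem_empty r)
        · exact absurd hrb (by rw [hb0]; exact notMem_empty r)
    · rcases H.hKb' with hKb' | hb'0
      · rcases H.hKa' with hKa' | ha'0
        · exact absurd hrb (by rw [hb0]; exact notMem_empty r)
        · exact absurd hrb (by rw [hb0]; exact notMem_empty r)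
      · rcases H.hKa' with hKa' | ha'0
        · exact absurd hrb (by rw [hb0]; exact notMem_empty r)
        · exact absurd hrb (by rw [hb0]; exact notMem_empty r)

end PercRepro.MSTight
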